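import Summits.RiemannHypothesis.RiemannHypothesis.Theorems.SemilocalPiecewiseCert
import HarnessLib

/-!
# Semi-local thresholds, negative side (IVb″): piecewise certificates — the atom side in chunks

Cell `rh-explicit` (HOME `run/shared/lean/pub/rh-explicit/`), seat cc-s2-4 gen11 (kernel column of the A4 SEMILOCAL-TABLE; a
one-lemma supplement to the piecewise-witness layer `SemilocalPiecewise{Witness,Increment,IncrementSum,Cert}.lean` of cc-s2-4
gen8).  Honest framing: bookkeeping for negative certificates about the tree's `weilSemilocalThreshold S`; nothing here bears on
RH.  No data is trusted.

WHY.  The kinked (piecewise-cubic) witnesses reach the TWIN-PRIME walls `q = 101, 107` (`HOME/cc-s2-4/gen10/kinked101/`), whose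
`S_q`-forms have 35 / 37 atoms below the window end; the single kernel fact `checkAtomsPW` of `SemilocalPiecewiseCert.lean` does
not go through at that size (see the note below), so the atom side is proved in two kernel facts and recombined here.
-/

set_option autoImplicit false
set_option linter.dupNamespace false  -- the mandated namespace repeats `RiemannHypothesis`

noncomputable section

open Complex Filter Set MeasureTheory Topology
open scoped Real

namespace Summit.RiemannHypothesis.RiemannHypothesis.Theorems.SemilocalPolyWitness

open MeasureTheory Set Finset Real
open Literature.NumberTheory.LFunctions
open Summit.RiemannHypothesis.RiemannHypothesis.Theorems.MotivicDoor
open LQ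

/-! ## Splitting the atom side of a piecewise certificate (kernel-memory lever for long atom tables)

One `decide +kernel` on `WeilNegCertPW.checkAtomsPW` evaluates the increment `D_k` of every atom's `t`-piece inside a single
kernel reduction; for the 35-atom table of the twin-prime wall `q = 101` this fails (measured 2026-08-24: 20 atoms reduce, 35 do
not — «did not reduce to isTrue/isFalse», the generic message `decide` prints for any kernel exception; the same happens when three
piece facts are conjoined, so the limit is the size of ONE kernel reduction, not recursion depth).  `atomChunkLe c l k B` bounds the
atom side of a sub-list by `B` in its own kernel fact, and `checkAtomsPW_of_chunks` recombines two chunks into the hypothesis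
`checkAtomsPW = true` of `weilSemilocalThreshold_le_of_checkPW[_sharp]` (elaborator only). -/

namespace WeilNegCertPW

/-- Splitting the atom side after a prefix: with `l₁.length = k₁.length`, the atom side of `l₁ ++ l₂` is the sum of the two
halves when both evaluate, and `none` otherwise. -/
theorem atomLhsPW_append (c : WeilNegCertPW) :
    ∀ (l₁ : List (ℕ × AtomQ)) (k₁ : List ℕ) (l₂ : List (ℕ × AtomQ)) (k₂ : List ℕ), l₁.length = k₁.length →
      c.atomLhsPW (l₁ ++ l₂) (k₁ ++ k₂) =
        (c.atomLhsPW l₁ k₁).bind fun A₁ ↦ (c.atomLhsPW l₂ k₂).map fun A₂ ↦ A₁ + A₂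
  | [], [], l₂, k₂, _ => by
      cases h : c.atomLhsPW l₂ k₂ <;> simp [WeilNegCertPW.atomLhsPW, h]
  | [], _ :: _, _, _, h => by simp at h
  | _ :: _, [], _, _, h => by simp at h
  | na :: rest, k :: ks, l₂, k₂, h => by
      have ih := atomLhsPW_append c rest ks l₂ k₂ (by simpa using h)
      cases hDk : c.D k <;> cases h₁ : c.atomLhsPW rest ks <;> cases h₂ : c.atomLhsPW l₂ k₂ <;>
        simp [WeilNegCertPW.atomLhsPW, hDk, h₁, h₂, ih]
      all_goals split_ifs <;> simp [add_assoc]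

/-- The atom side of a sub-list `l` (piece indices `k`) is at most `B`. -/
def atomChunkLe (c : WeilNegCertPW) (l : List (ℕ × AtomQ)) (k : List ℕ) (B : ℚ) : Bool :=
  match c.atomLhsPW l k with
  | some A => decide (A ≤ B)
  | none => false

/-- Two chunk facts (the first `n` atoms bounded by `B₁`, the rest by `B₂`) with `B₁ + B₂ ≤ atomB` give `checkAtomsPW = true`. -/
theorem checkAtomsPW_of_chunks (c : WeilNegCertPW) (n : ℕ) (B₁ B₂ : ℚ)
    (hlen : (c.atoms.take n).length = (c.atomPiece.take n).length)
    (h₁ : c.atomChunkLe (c.atoms.take n) (c.atomPiece.take n) B₁ = true)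
    (h₂ : c.atomChunkLe (c.atoms.drop n) (c.atomPiece.drop n) B₂ = true) (hB : B₁ + B₂ ≤ c.atomB) :
    c.checkAtomsPW = true := by
  unfold atomChunkLe at h₁ h₂
  cases e₁ : c.atomLhsPW (c.atoms.take n) (c.atomPiece.take n) with
  | none => simp [e₁] at h₁
  | some A₁ =>
    cases e₂ : c.atomLhsPW (c.atoms.drop n) (c.atomPiece.drop n) with
    | none => simp [e₂] at h₂
    | some A₂ =>
      simp only [e₁, decide_eq_true_eq] at h₁
      simp only [e₂, decide_eq_true_eq] at h₂
      have e := c.atomLhsPW_append (c.atoms.take n) (c.atomPiece.take n) (c.atoms.drop n) (c.atomPiece.drop n) hlen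
      rw [List.take_append_drop, List.take_append_drop, e₁, e₂] at e
      have e' : c.atomLhsPW c.atoms c.atomPiece = some (A₁ + A₂) := by rw [e]; rfl
      unfold checkAtomsPW
      rw [e']
      show decide (A₁ + A₂ ≤ c.atomB) = true
      simp only [decide_eq_true_eq]
      linarith


/-- Two chunk facts on adjacent sub-lists combine to a chunk fact on their concatenation (bound `B₁ + B₂`). -/
theorem atomChunkLe_append (c : WeilNegCertPW) (l₁ : List (ℕ × AtomQ)) (k₁ : List ℕ) (l₂ : List (ℕ × AtomQ)) (k₂ : List ℕ)
    (B₁ B₂ : ℚ) (hlen : l₁.length = k₁.length) (h₁ : c.atomChunkLe l₁ k₁ B₁ = true)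
    (h₂ : c.atomChunkLe l₂ k₂ B₂ = true) : c.atomChunkLe (l₁ ++ l₂) (k₁ ++ k₂) (B₁ + B₂) = true := by
  unfold atomChunkLe at h₁ h₂ ⊢
  rw [c.atomLhsPW_append l₁ k₁ l₂ k₂ hlen]
  cases e₁ : c.atomLhsPW l₁ k₁ with
  | none => simp [e₁] at h₁
  | some A₁ =>
    cases e₂ : c.atomLhsPW l₂ k₂ with
    | none => simp [e₂] at h₂
    | some A₂ =>
      simp only [e₁, decide_eq_true_eq] at h₁
      simp only [e₂, decide_eq_true_eq] at h₂
      show decide (A₁ + A₂ ≤ B₁ + B₂) = true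
      simp only [decide_eq_true_eq]
      linarith

/-- A chunk fact on the whole atom table with `B ≤ atomB` gives `checkAtomsPW = true` (so any number of chunk facts, combined with
`atomChunkLe_append`, discharge the atom side). -/
theorem checkAtomsPW_of_atomChunkLe (c : WeilNegCertPW) (B : ℚ) (h : c.atomChunkLe c.atoms c.atomPiece B = true)
    (hB : B ≤ c.atomB) : c.checkAtomsPW = true := by
  unfold atomChunkLe at h
  unfold checkAtomsPW
  cases e : c.atomLhsPW c.atoms c.atomPiece with
  | none => simp [e] at h
  | some A =>
    simp only [e, decide_eq_true_eq] at h
    show decide (A ≤ c.atomB) = true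
    simp only [decide_eq_true_eq]
    linarith

end WeilNegCertPW

end Summit.RiemannHypothesis.RiemannHypothesis.Theorems.SemilocalPolyWitness

end
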